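import Literature.Algebra.Homology.GroupHomologyPermutationModuleInvariants
import HarnessLib

/-!
# The averaging projector onto `H₁(Γ, k[S])^H` and the `S`-spread of a map on the invariants

Topic `Literature/Algebra/Homology`; namespace `Literature.Algebra.Homology.PermutationCoeff`; sequel of
`GroupHomologyPermutationModuleInvariants` (`H1RightRep`, `H1Invariants`).  Definitions with bodies + proved
theorems; no named fact, no `sorry`, no instance, no notation.

For a finite subgroup `H ≤ S` with `|H| ∈ kˣ`:
* **`avgProj φ H = ⅟|H| Σ_{h ∈ H} h·`** on `H₁(Γ, k[S])`: values in the invariants (`avgProj_mem`), identity on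
  them (`avgProj_eq_self`), idempotent (`avgProj_avgProj`), `e_H ∘ h = e_H` (`avgProj_H1RightRep`); as a
  surjection **`toInvariants φ H : H₁(Γ, k[S]) ↠ H1Invariants k φ H`** (`toInvariants_surjective`).
* **`spread φ H L : H₁(Γ, k[S]) →ₗ[k] (S → V)`**, `z ↦ (g ↦ L(e_H(g·z)))`, for any `k`-linear
  `L : H1Invariants k φ H →ₗ[k] V`: the co-induction / Frobenius-reciprocity map
  `Hom_H(Res M, V) → Hom_S(M, Fun(S, V))`; **`spread_H1RightRep`** (equivariance: `spread L (g₀·z) = R_{g₀}(spread L z)`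
  for the right-translation action on functions), `spread_apply_mul_left` (constant on left `H`-cosets),
  `spread_apply_one` (recovers `L` on invariants), `spread_eq_zero_of` (the kernel is `S`-stable).

Consumer (route BSD/TeichmullerTwistDescent, crux `TwistedPeriodLatticeSaturation`, K-line memo CARRIER-gen1 §4):
with `S = GL₂(ℤ/p)`, `H = T̃` and `L` = (up/down dictionary `torusInvariantsToCuspidal`) followed by a period map of
a newform `f`, `range (spread L)` is the `GL₂(ℤ/p)`-LATTICE `Λ_Q` of the K-line, defined without Hecke operators.
Nothing about modular curves is asserted here.

## References
* K. S. Brown, *Cohomology of Groups* (1982), Ch. III §5 (co-induced modules `Hom(ℤG, −)`, (5.8)–(5.9)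
  Frobenius reciprocity), §9 (averaging for a finite group of invertible order). [Brown1982]
-/

noncomputable section

open CategoryTheory groupHomology Finsupp

universe u v

namespace Literature.Algebra.Homology

namespace PermutationCoeff

variable {k : Type u} [CommRing k] {Γ S : Type u} [Group Γ] [Group S] (φ : Γ →* S)
variable (H : Subgroup S) [Fintype H] [Invertible (Fintype.card H : k)]

/-! ### The averaging projector onto the `H`-invariants of `H₁(Γ, k[S])` -/

/-- The averaging projector `e_H = ⅟|H| Σ_{h ∈ H} h·` on `H₁(Γ, k[S])`. [cite: Brown1982, Ch. III §9 (averaging)] -/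
def avgProj : H1 (permRepObj k φ S) →ₗ[k] H1 (permRepObj k φ S) :=
  ⅟(Fintype.card H : k) • ∑ h : H, H1RightRep k φ (h : S)

omit [Invertible (Fintype.card H : k)] in
/-- `Σ_{h ∈ H} h·(h₀·z) = Σ_{h ∈ H} h·z` (reindexing). [cite: Brown1982, Ch. III §9] -/
theorem sum_H1RightRep_mul (h₀ : H) (z : H1 (permRepObj k φ S)) :
    ∑ h : H, H1RightRep k φ (h : S) (H1RightRep k φ (h₀ : S) z) = ∑ h : H, H1RightRep k φ (h : S) z := by
  simp only [← Module.End.mul_apply, ← map_mul]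
  exact Fintype.sum_equiv (Equiv.mulRight h₀) _ _ (fun h => by simp)

omit [Invertible (Fintype.card H : k)] in
/-- `h₀·(Σ_{h ∈ H} h·z) = Σ_{h ∈ H} h·z`. [cite: Brown1982, Ch. III §9] -/
theorem H1RightRep_sum (h₀ : H) (z : H1 (permRepObj k φ S)) :
    H1RightRep k φ (h₀ : S) (∑ h : H, H1RightRep k φ (h : S) z) = ∑ h : H, H1RightRep k φ (h : S) z := by
  rw [map_sum]
  simp only [← Module.End.mul_apply, ← map_mul]
  exact Fintype.sum_equiv (Equiv.mulLeft h₀) _ _ (fun h => by simp)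

/-- Unfolding `avgProj`. [cite: Brown1982, Ch. III §9] -/
theorem avgProj_apply (z : H1 (permRepObj k φ S)) :
    avgProj φ H z = ⅟(Fintype.card H : k) • ∑ h : H, H1RightRep k φ (h : S) z := by
  simp [avgProj, LinearMap.sum_apply]

/-- `e_H z` is `H`-invariant. [cite: Brown1982, Ch. III §9] -/
theorem avgProj_mem (z : H1 (permRepObj k φ S)) : avgProj φ H z ∈ H1Invariants k φ H := by
  rw [mem_H1Invariants_iff]
  intro h
  rw [avgProj_apply, map_smul, H1RightRep_sum]

/-- `e_H z = z` for `H`-invariant `z`. [cite: Brown1982, Ch. III §9] -/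
theorem avgProj_eq_self {z : H1 (permRepObj k φ S)} (hz : z ∈ H1Invariants k φ H) : avgProj φ H z = z := by
  rw [avgProj_apply, Finset.sum_congr rfl (fun h _ => (mem_H1Invariants_iff φ H z).1 hz h), Finset.sum_const,
    Finset.card_univ, ← Nat.cast_smul_eq_nsmul k, smul_smul, invOf_mul_self, one_smul]

/-- `e_H` is idempotent. [cite: Brown1982, Ch. III §9] -/
theorem avgProj_avgProj (z : H1 (permRepObj k φ S)) : avgProj φ H (avgProj φ H z) = avgProj φ H z :=
  avgProj_eq_self φ H (avgProj_mem φ H z)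

/-- `e_H ∘ h₀ = e_H` for `h₀ ∈ H`. [cite: Brown1982, Ch. III §9] -/
theorem avgProj_H1RightRep (h₀ : H) (z : H1 (permRepObj k φ S)) :
    avgProj φ H (H1RightRep k φ (h₀ : S) z) = avgProj φ H z := by
  rw [avgProj_apply, avgProj_apply, sum_H1RightRep_mul]

/-- The averaging projector as a surjection onto the invariants `H₁(Γ, k[S]) ↠ H₁(Γ, k[S])^H`.
[cite: Brown1982, Ch. III §9] -/
def toInvariants : H1 (permRepObj k φ S) →ₗ[k] H1Invariants k φ H :=
  LinearMap.codRestrict _ (avgProj φ H) (avgProj_mem φ H)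

/-- `toInvariants z = e_H z`. [cite: Brown1982, Ch. III §9] -/
theorem coe_toInvariants (z : H1 (permRepObj k φ S)) : (toInvariants φ H z : H1 (permRepObj k φ S)) = avgProj φ H z :=
  rfl

/-- `toInvariants` restricted to the invariants is the identity. [cite: Brown1982, Ch. III §9] -/
theorem toInvariants_coe (z : H1Invariants k φ H) : toInvariants φ H (z : H1 (permRepObj k φ S)) = z :=
  Subtype.ext (avgProj_eq_self φ H z.2)

/-- `toInvariants` is onto. [cite: Brown1982, Ch. III §9] -/
theorem toInvariants_surjective : Function.Surjective (toInvariants (k := k) φ H) :=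
  fun z => ⟨z.1, toInvariants_coe φ H z⟩

/-! ### Spreading a map on the invariants over the group: `z ↦ (g ↦ L(e_H(g·z)))` -/

section Spread

variable {V : Type v} [AddCommGroup V] [Module k V] (L : H1Invariants k φ H →ₗ[k] V)

/-- **The `S`-spread of `L`**: `z ↦ (g ↦ L(e_H(g·z)))`, `H₁(Γ, k[S]) → Fun(S, V)`. [cite: Brown1982, Ch. III §5 (co-induction `Hom(ℤG, −)`)] -/
def spread : H1 (permRepObj k φ S) →ₗ[k] (S → V) where
  toFun z g := L (toInvariants φ H (H1RightRep k φ g z))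
  map_add' z₁ z₂ := by ext g; simp
  map_smul' c z := by ext g; simp

/-- Unfolding `spread`. [cite: Brown1982, Ch. III §5] -/
theorem spread_apply (z : H1 (permRepObj k φ S)) (g : S) :
    spread φ H L z g = L (toInvariants φ H (H1RightRep k φ g z)) := rfl

/-- **Equivariance of the spread**: `spread L (g₀·z) = (g ↦ spread L z (g g₀))` — the spread intertwines the
action on `H₁(Γ, k[S])` with right translation of functions on `S`. [cite: Brown1982, Ch. III §5] -/
theorem spread_H1RightRep (g₀ : S) (z : H1 (permRepObj k φ S)) :
    spread φ H L (H1RightRep k φ g₀ z) = fun g => spread φ H L z (g * g₀) := by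
  ext g
  rw [spread_apply, spread_apply, ← Module.End.mul_apply, ← map_mul]

/-- The spread is constant on left `H`-cosets in the function variable: `spread L z (h g) = spread L z g`.
[cite: Brown1982, Ch. III §5] -/
theorem spread_apply_mul_left (h : H) (z : H1 (permRepObj k φ S)) (g : S) :
    spread φ H L z ((h : S) * g) = spread φ H L z g := by
  rw [spread_apply, spread_apply, map_mul, Module.End.mul_apply]
  congr 1
  apply Subtype.ext
  rw [coe_toInvariants, coe_toInvariants, avgProj_H1RightRep]

/-- The kernel of the spread is `S`-stable. [cite: Brown1982, Ch. III §5] -/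
theorem spread_eq_zero_of (g₀ : S) {z : H1 (permRepObj k φ S)} (hz : spread φ H L z = 0) :
    spread φ H L (H1RightRep k φ g₀ z) = 0 := by
  rw [spread_H1RightRep, hz]
  rfl

/-- The value at `1` of the spread restricted to invariants recovers `L`. [cite: Brown1982, Ch. III §5] -/
theorem spread_apply_one (z : H1Invariants k φ H) : spread φ H L (z : H1 (permRepObj k φ S)) 1 = L z := by
  rw [spread_apply, map_one, Module.End.one_apply, toInvariants_coe]

end Spread

end PermutationCoeff

end Literature.Algebra.Homology
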